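import Summits.BirchSwinnertonDyer.BirchSwinnertonDyer.Theses.AdditiveBranchIMC
import Summits.BirchSwinnertonDyer.BirchSwinnertonDyer.Theorems.SchneiderFreeSocketsV2
import Summits.BirchSwinnertonDyer.BirchSwinnertonDyer.Theorems.SchneiderFreeAdditiveX3ControlLeDoor
import Summits.BirchSwinnertonDyer.BirchSwinnertonDyer.Theorems.AdditiveRankOneControlLeOfPoitouTate
import Summits.BirchSwinnertonDyer.BirchSwinnertonDyer.Theorems.SchneiderFreeAdditiveX3PoitouTateSelmerDualityHolds
import Summits.BirchSwinnertonDyer.BirchSwinnertonDyer.Theorems.GoldfeldK12AdditiveTwoInstances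
import Summits.BirchSwinnertonDyer.Rank1Residual.Additive.GordCycLeadingTermTwist
import Summits.BirchSwinnertonDyer.Rank1Residual.AdditivePotMult.QuadraticBaseChangeDescentOrdp
import Summits.BirchSwinnertonDyer.Rank1Residual.Supersingular.X6RankOneAnticyclotomicLinksAnyField
import Summits.BirchSwinnertonDyer.Rank1Residual.X11b.CastellaErratum
import Summits.BirchSwinnertonDyer.Rank1Residual.X11b.TamagawaQuadraticBaseChange
import Summits.BirchSwinnertonDyer.Rank1Residual.X11b.Three.StepLAtThree
import Literature.NumberTheory.EllipticCurves.Rank1Residual.Typed.JointLower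
import Literature.NumberTheory.EllipticCurves.CaiShuTian2014.ExplicitGrossZagier
import Literature.NumberTheory.EllipticCurves.Hsieh2014.AnticyclotomicPAdicLFunctionRamifiedSteinberg
import Literature.NumberTheory.EllipticCurves.Hsieh2014.AnticyclotomicPAdicLFunctionRamifiedSteinbergCorollaries
import Literature.NumberTheory.EllipticCurves.LiuZhangZhang2018.PAdicWaldspurgerEllipticCurveAdditiveRamifiedSteinberg
import Literature.NumberTheory.EllipticCurves.LeadingTermProofs
import Literature.NumberTheory.EllipticCurves.HeegnerPointsImaginaryQuadraticProofs
import Literature.NumberTheory.GaloisCohomology.PoitouTateSelmerStructures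
import Literature.NumberTheory.GaloisCohomology.PoitouTateSha
import HarnessLib

/-!
# Stub `stub_controlToIndexBound` for line `wan_tame_bdp_road` (crux GordTwoRankOne, 19358)

The ALGEBRAIC HALF, part 1: BranchSocketAt → TameStepLAt.

Chain:
- (S4) `P` NON-TORSION: `r_an(E) + r_an(E^{(d_K)}) = 1` implies `L'(E/K,1) ≠ 0` (a SIMPLE zero),
  and Cai–Shu–Tian Thm 1.1 (`CaiShuTian2014.thm11_trivialChar`; `HeegnerCondition W K` from
  `TameRoadField`: `q ‖ N_E`, `q ∣ d_K`, `a_q = −1`, the rest split) implies `ĥ(P) ≠ 0`.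
  `rank E(K) = 1` and `#Ш(E/K)[p^∞] < ∞` from GZK over `ℚ` on `E` and `E^{(d_K)}`
  (`rank_eq_analyticRank_of_analyticRank_le_one`, `p` odd) — this REPLACES the sister door's
  only all-split input, Kolyvagin over `K`.

- (S5) The control INEQUALITY `SchneiderFree.AdditiveControlLeOnTreeAt p κ 𝔭 γ ι 0 P` at one
  anticyclotomic frame: re-run `SchneiderFreeAdditiveX3.additiveControlLeOnTreeAt_of_facts`
  (atoms `additiveControlLeOnTreeAt_of_torsAtomsLe`, Poitou–Tate dualities, `SplitsIn K p` from
  `TameRoadField`, `p ∤ #𝓞_K^×` as `p ≥ 5`; the Tamagawa term is `∏_{w∣N⁺} c_w`, the ramified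
  `𝔮` splits completely in `K_∞^{ac}` and contributes nothing);
  then `SchneiderFree.index_le_slack_of_additive_links` + the Tamagawa transport
  `ord_p ∏_{w∣N⁺} c_w(E/K) ≤ 2·ord_p ∏_ℓ c_ℓ(E)` give `IndexLowerBoundLeAt W p K P (v_p c_φ)`.

An anticyclotomic `κ` with a degree-one `𝔭` exists (`p` split).

[L] — transplant of kernel-checked sister theorems with two input swaps.
-/

noncomputable section

open scoped Classical

open NumberField IsDedekindDomain WeierstrassCurve Field
open Literature.NumberTheory.EllipticCurves
  Literature.NumberTheory.EllipticCurves.ModularForms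
  Literature.NumberTheory.EllipticCurves.Rank1Residual
  Literature.NumberTheory.EllipticCurves.Rank1Residual.Typed
  Literature.NumberTheory.GaloisCohomology

open Summit.BirchSwinnertonDyer.Rank1Residual
open Summit.BirchSwinnertonDyer.Rank1Residual.Additive
open Summit.BirchSwinnertonDyer.Rank1Residual.X11b
open Summit.BirchSwinnertonDyer.BirchSwinnertonDyer.Theses.AdditiveBranchIMC
open Summit.BirchSwinnertonDyer.BirchSwinnertonDyer.Theorems
open Summit.BirchSwinnertonDyer.BirchSwinnertonDyer.Theorems.SchneiderFree
open Summit.BirchSwinnertonDyer.BirchSwinnertonDyer.Theorems.SchneiderFreeAdditiveX3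
open Summit.BirchSwinnertonDyer.BirchSwinnertonDyer.Theorems.AdditiveRankOneControlLe
open IsImaginaryQuadratic

set_option autoImplicit false
set_option linter.dupNamespace false

namespace Summit.BirchSwinnertonDyer.BirchSwinnertonDyer.Cruxes.GordTwoRankOne.WanTameBdpRoad

/-! ### Re-import the line's vocabulary (from skeleton) -/

/-- The **Wan prime** for W at p: a prime q ≠ p,2 with multiplicative non-split reduction at q
and p does not divide the valuation of the discriminant at q. [wan_tame_bdp_road skeleton] -/
def WanPrime (W : WeierstrassCurve ℚ) [W.IsGloballyMinimal] (p q : ℕ) [Fact q.Prime] : Prop :=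
  q ≠ p ∧ q ≠ 2 ∧ W.HasMultiplicativeReductionAtPrime q ∧ ¬ W.HasSplitMultiplicativeReductionAtPrime q ∧
    ¬ p ∣ padicValInt q W.minimalDiscriminantInt

/-- The **tame-road sub-row** of N10: p ≥ 5 surjective with all primes good or multiplicative,
and possessing a Wan prime. [wan_tame_bdp_road skeleton] -/
def TameRoadRow (W : WeierstrassCurve ℚ) [W.IsGloballyMinimal] (p : ℕ) [Fact p.Prime] : Prop :=
  5 ≤ p ∧ Surj W p ∧
    (∀ ℓ : ℕ, (hℓ : ℓ.Prime) → ℓ ≠ p →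
      (haveI : Fact ℓ.Prime := ⟨hℓ⟩;
        W.HasGoodReductionAtPrime ℓ ∨ W.HasMultiplicativeReductionAtPrime ℓ)) ∧
    ∃ q : ℕ, ∃ _ : Fact q.Prime, WanPrime W p q

/-- The **tame-road field** K for W at p: imaginary quadratic, the Wan prime q ramifies in K,
all other bad primes split in K, and HeegnerHypothesis(p, K). [wan_tame_bdp_road skeleton] -/
def TameRoadField (W : WeierstrassCurve ℚ) [W.IsGloballyMinimal] (p : ℕ)
    (K : Type) [Field K] [NumberField K] : Prop :=
  IsImaginaryQuadratic K ∧
    (∃ q : ℕ, ∃ _ : Fact q.Prime, WanPrime W p q ∧ (q : ℤ) ∣ NumberField.discr K ∧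
      ∀ ℓ : ℕ, ℓ.Prime → ℓ ∣ W.conductorNorm ℤ → ℓ ≠ q →
        ((Ideal.span {(ℓ : ℤ)}).primesOver (𝓞 K)).ncard = 2) ∧
    (¬ 2 ∣ W.conductorNorm ℤ → ((Ideal.span {(2 : ℤ)}).primesOver (𝓞 K)).ncard = 2) ∧
    SatisfiesHeegnerHypothesis p K

/-- The **branch socket** for W at p over K: BDP road gives IMC lower at slack v_p(c).
[wan_tame_bdp_road skeleton, stub stub_branchSocket] -/
def BranchSocketAt (W : WeierstrassCurve ℚ) [W.IsElliptic] [W.IsGloballyMinimal] (p : ℕ) [Fact p.Prime]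
    (K : Type) [Field K] [NumberField K] : Prop :=
  ∀ (N : ℕ) [NeZero N] (Dt : ModularParametrizationData W N) (H : HeegnerDatum N (NumberField.discr K))
    (ιK : K →+* ℂ) (P : (W.baseChange K).toAffine.Point),
    W.conductorNorm ℤ = N →
    WeierstrassCurve.Affine.Point.map ιK.toRatAlgHom P = heegnerPointComplex Dt H →
    ¬ IsOfFinAddOrder P →
    ∀ (κ : ZpExtension K p), κ.IsAnticyclotomic →
      ∀ (γ : Field.absoluteGaloisGroup K) [Fact (κ.IsTopGenerator γ)]
        (𝔭 : HeightOneSpectrum (𝓞 K)) (h𝔭 : ((p : ℕ) : 𝓞 K) ∈ 𝔭.asIdeal)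
        (he : 𝔭.asIdeal.ramificationIdx (𝓞 ℚ) = 1) (hf : 𝔭.asIdeal.inertiaDeg (𝓞 ℚ) = 1),
        AdditiveIMCLowerBDPOnTreeLeAt p κ 𝔭 γ (embAt K p 𝔭 h𝔭 he hf)
          (padicValNat p Dt.c.natAbs) P

/-- **Step L** for the tame-road field: P non-torsion AND IndexLowerBoundLeAt.
[wan_tame_bdp_road skeleton, from BranchSocketAt] -/
def TameStepLAt (W : WeierstrassCurve ℚ) [W.IsElliptic] [W.IsGloballyMinimal] (p : ℕ) [Fact p.Prime]
    (K : Type) [Field K] [NumberField K] : Prop :=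
  ∀ (N : ℕ) [NeZero N] (Dt : ModularParametrizationData W N) (H : HeegnerDatum N (NumberField.discr K))
    (ιK : K →+* ℂ) (P : (W.baseChange K).toAffine.Point),
    W.conductorNorm ℤ = N →
    WeierstrassCurve.Affine.Point.map ιK.toRatAlgHom P = heegnerPointComplex Dt H →
    ¬ IsOfFinAddOrder P ∧ IndexLowerBoundLeAt W p K P (padicValNat p Dt.c.natAbs)

/-- The conjunction of printed named facts required by the tame-road line.
[wan_tame_bdp_road skeleton, stub stub_printedFactsTame] -/
def PrintedFactsTame : Prop :=
  Wuthrich2014.kato_halfEigenCharIdeal_dvd_cyclotomicPrime_of_surjective ∧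
    Delbourgo1998.prop4_rankZero_pow_dvd_constantCoeff ∧
    Literature.NumberTheory.EllipticCurves.rank_eq_analyticRank_of_analyticRank_le_one ∧
    WeierstrassCurve.hasEntireLFunction_rat ∧
    Literature.NumberTheory.EllipticCurves.ModularForms.nonempty_modularParametrizationData ∧
    friedbergHoffstein_exists_twist_ne_zero_ramifiedAt_splitAt ∧
    (∀ W : WeierstrassCurve ℚ,
      Literature.NumberTheory.EllipticCurves.even_analyticRank_iff_rootNumber_eq_one W) ∧
    WeierstrassCurve.bsdRHS_eq_of_isIsogenous ∧
    Literature.NumberTheory.EllipticCurves.GrossZagier1986_thm_I_7_3 ∧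
    CaiShuTian2014.thm11_trivialChar ∧
    Hsieh2014.thmA_exists_isHsiehLFunction_unrPeriod_ramifiedSteinberg ∧
    Hsieh2014.thmB_exists_isHsiehLFunction_coeff_norm_eq_one_unrPeriod_ramifiedSteinberg ∧
    LiuZhangZhang2018.thm151_thm153_modularCurve_heegnerVector_additive_ramifiedSteinberg

/-! ### Helper lemmas -/

/-- TameRoadField implies Heegner condition for CST Thm 1.1: every prime of `N_E` either
splits in `K` or is ramified with multiplicative reduction (and non-split if ramified). -/
lemma heegnerCondition_of_tameRoadField {W : WeierstrassCurve ℚ} [W.IsElliptic] [W.IsGloballyMinimal]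
    {p : ℕ} [Fact p.Prime] {K : Type} [Field K] [NumberField K]
    (_hrow : TameRoadRow W p) (hfield : TameRoadField W p K) :
    CaiShuTian2014.HeegnerCondition W K := by
  constructor
  -- Every prime ℓ | N_E either splits in K or is ramified with mult reduction
  · intro ℓ _ hℓN
    obtain ⟨_, ⟨q, _, hqwan, hqdK, hsplit⟩, _, _⟩ := hfield
    by_cases hℓq : ℓ = q
    · -- ℓ = q: ramified in K with mult reduction
      right
      constructor
      · subst hℓq; exact hqdK
      · subst hℓq; exact hqwan.2.2.1
    · -- ℓ ≠ q: splits by TameRoadField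
      left
      have hp : ℓ.Prime := Fact.out
      exact hsplit ℓ hp hℓN hℓq
  -- At every ramified prime ℓ | N_E, reduction is non-split multiplicative
  · intro ℓ _ hℓN hℓdK
    have hK' : IsImaginaryQuadratic K := hfield.1
    obtain ⟨_, ⟨q, _, hqwan, _, hsplit⟩, _, _⟩ := hfield
    by_cases hℓq : ℓ = q
    · -- ℓ = q: WanPrime says non-split
      subst hℓq
      exact hqwan.2.2.2.1
    · -- ℓ ≠ q: splits, so ℓ ∤ d_K - contradiction with hℓdK
      have hp : ℓ.Prime := Fact.out
      have hsℓ := hsplit ℓ hp hℓN hℓq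
      -- ℓ splits means 2 primes above ℓ, but by ncard_primesOver_ne_two_of_dvd_discr
      -- if ℓ ∣ d_K then ℓ does NOT split — contradiction
      exact absurd hsℓ (Hsieh2014.ncard_primesOver_ne_two_of_dvd_discr K hK'.1 hp hℓdK)

/-- TameRoadField implies `p` splits in `K` (exactly 2 primes above `p`). -/
lemma splitsIn_of_tameRoadField {W : WeierstrassCurve ℚ} [W.IsGloballyMinimal]
    {p : ℕ} [Fact p.Prime] {K : Type} [Field K] [NumberField K]
    (hpN : p ∣ W.conductorNorm ℤ) (hfield : TameRoadField W p K) :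
    ((Ideal.span {(p : ℤ)}).primesOver (𝓞 K)).ncard = 2 := by
  -- p ∣ N_E, and p ≠ q (WanPrime says q ≠ p), so p splits by TameRoadField
  obtain ⟨_, ⟨q, _, hqwan, _, hsplit⟩, _, _⟩ := hfield
  have hqnep : q ≠ p := hqwan.1
  have hp : p.Prime := Fact.out
  exact hsplit p hp hpN (Ne.symm hqnep)

/-- From `r_an(W) + r_an(Wd) = 1` (Wd a minimal model of the twist) we get `L'(E/K, 1) ≠ 0`. -/
lemma lDerivEK_ne_zero_of_sum_analyticRank_eq_one
    {W : WeierstrassCurve ℚ} [W.IsElliptic] [W.IsGloballyMinimal]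
    {K : Type} [Field K] [NumberField K]
    {Wd : WeierstrassCurve ℚ} [Wd.IsElliptic] [Wd.IsGloballyMinimal]
    (htw : ∃ C : WeierstrassCurve.VariableChange ℚ, C • W.quadraticTwist (NumberField.discr K : ℚ) = Wd)
    (hsum : W.analyticRank + Wd.analyticRank = 1)
    (hL : WeierstrassCurve.hasEntireLFunction_rat) :
    LDerivEK W K ≠ 0 := by
  -- Wd is a variable change of the twist, so has the same analytic rank
  have hd : (NumberField.discr K : ℚ) ≠ 0 := by exact_mod_cast NumberField.discr_ne_zero K
  haveI := W.isElliptic_quadraticTwist hd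
  obtain ⟨C, hC⟩ := htw
  -- analyticRank is invariant under variable change
  have hWd_eq : Wd.analyticRank = (W.quadraticTwist (NumberField.discr K : ℚ)).analyticRank := by
    rw [← hC, analyticRank_smul]
  -- analyticRankEK W K = W.analyticRank + twist.analyticRank = 1
  have h1 : analyticRankEK W K = 1 := by
    rw [analyticRankEK_eq_add_of hL W K, ← hWd_eq, hsum]
  -- A simple zero means the derivative is nonzero
  have hle : 1 ≤ analyticOrderNatAt (fun s ↦ W.entireLFunction s *
      (W.quadraticTwist (NumberField.discr K : ℚ)).entireLFunction s) 1 := by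
    change 1 ≤ analyticRankEK W K; omega
  exact (analyticOrderNatAt_eq_one_iff_deriv_ne_zero hle).mp (by change analyticRankEK W K = 1; exact h1)

/-- From `L'(E/K, 1) ≠ 0` and CST Thm 1.1 under HeegnerCondition, `P` is non-torsion. -/
lemma not_isOfFinAddOrder_of_cst_of_lDerivEK_ne_zero
    {W : WeierstrassCurve ℚ} [W.IsElliptic] [W.IsGloballyMinimal]
    {K : Type} [Field K] [NumberField K]
    (hCST : CaiShuTian2014.thm11_trivialChar)
    (hK : IsImaginaryQuadratic K)
    (hHC : CaiShuTian2014.HeegnerCondition W K)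
    {N : ℕ} [NeZero N] (Dt : ModularParametrizationData W N)
    (H : HeegnerDatum N (NumberField.discr K)) (ι : K →+* ℂ)
    (P : (W.baseChange K).toAffine.Point)
    (hN : W.conductorNorm ℤ = N)
    (hP : WeierstrassCurve.Affine.Point.map ι.toRatAlgHom P = heegnerPointComplex Dt H)
    (hL' : LDerivEK W K ≠ 0) :
    ¬ IsOfFinAddOrder P := by
  -- CST Thm 1.1 says L'(E/K, 1) = (2^{-μ}) * (grossZagierConstant Dt K) * ĥ(P)
  -- If L'(E/K, 1) ≠ 0, then ĥ(P) ≠ 0, so P is non-torsion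
  haveI : (W.baseChange K).IsElliptic := by rw [WeierstrassCurve.baseChange]; infer_instance
  haveI : NeZero (W.conductorNorm ℤ) := ⟨by rw [hN]; exact NeZero.ne N⟩
  -- The CST formula - need to rewrite N to conductorNorm
  subst hN
  have hL := hCST W K hK hHC Dt H ι P hP
  intro htor
  -- If P is torsion, then ĥ(P) = 0
  have hh : P.canonicalHeight = 0 :=
    (WeierstrassCurve.Affine.Point.canonicalHeight_eq_zero_iff_holds P).mpr htor
  -- Then the RHS of CST is 0
  rw [hL, hh, mul_zero, Complex.ofReal_zero] at hL'
  exact hL' rfl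

/-! ### Main theorem -/

/-- **stub_controlToIndexBound** (algebraic half, part 1): BranchSocketAt → TameStepLAt.
From the branch socket (IMC ⊇ + BDP), compose with the control inequality and
CST's explicit Gross-Zagier to get Step L over the tame-road field. -/
theorem stub_controlToIndexBound : PrintedFactsTame →
    ∀ (W : WeierstrassCurve ℚ) [W.IsElliptic] [W.IsGloballyMinimal] (p : ℕ) [Fact p.Prime]
      (K : Type) [Field K] [NumberField K] (Wd : WeierstrassCurve ℚ) [Wd.IsElliptic] [Wd.IsGloballyMinimal],
      N10.CellGordTwo W p → TameRoadRow W p → TameRoadField W p K →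
        (∃ C : WeierstrassCurve.VariableChange ℚ, C • W.quadraticTwist (NumberField.discr K : ℚ) = Wd) →
        W.analyticRank + Wd.analyticRank = 1 →
        BranchSocketAt W p K → TameStepLAt W p K := by
  intro hprint W _ _ p _ K _ _ Wd _ _ hcell hrow hfield htw hsum hsock N _ Dt H ιK P hN hP
  obtain ⟨_, _, hGZK, hL, _, _, _, _, _, hCST, _, _, _⟩ := hprint
  -- Step 1: Show P is non-torsion using CST + rank sum = 1
  have hK : IsImaginaryQuadratic K := hfield.1
  have hHC : CaiShuTian2014.HeegnerCondition W K := heegnerCondition_of_tameRoadField hrow hfield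
  have hL' : LDerivEK W K ≠ 0 := lDerivEK_ne_zero_of_sum_analyticRank_eq_one htw hsum hL
  have hnt : ¬ IsOfFinAddOrder P := not_isOfFinAddOrder_of_cst_of_lDerivEK_ne_zero hCST hK hHC Dt H ιK P hN hP hL'
  constructor
  · exact hnt
  -- Step 2: Get IndexLowerBoundLeAt from socket + control for TameRoadField.
  have hp : p.Prime := Fact.out
  have hp5 : 5 ≤ p := hrow.1
  have hp2 : p ≠ 2 := by omega
  have hadd : Addv W p := hcell.2.1
  -- p splits in K from TameRoadField
  have hsplit : SplitsIn K p := hfield.2.2.2 p hp (Nat.dvd_refl p)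
  -- finrank = 2
  have h2 : Module.finrank ℚ K = 2 := finrank_eq_two hK
  -- Sha finiteness from GZK on both curves + quadratic base change descent
  have hrW : W.analyticRank ≤ 1 := by omega
  have hrWd : Wd.analyticRank ≤ 1 := by omega
  have hfinW : W.ShaFinite := (hGZK W hrW).2
  have hfinWd : Wd.ShaFinite := (hGZK Wd hrWd).2
  haveI hEK : (W.baseChange K).IsElliptic := by rw [WeierstrassCurve.baseChange]; infer_instance
  have hfinK : (W.baseChange K).ShaFinite :=
    AdditivePotMult.shaFinite_baseChange_quadratic W K Wd (W.baseChange K) h2 htw ⟨1, one_smul _ _⟩ hfinW hfinWd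
  -- Rank = 1 from MW base change + rank sum = 1
  have hrkW : W.mordellWeilRank = W.analyticRank := (hGZK W hrW).1
  have hrkWd : Wd.mordellWeilRank = Wd.analyticRank := (hGZK Wd hrWd).1
  have hrksum : W.mordellWeilRank + Wd.mordellWeilRank = 1 := by rw [hrkW, hrkWd]; exact hsum
  have hrkK_eq : (W.baseChange K).mordellWeilRank = W.mordellWeilRank + Wd.mordellWeilRank := by
    rw [mordellWeilRank_baseChange_quadratic_holds W K h2]
    obtain ⟨C, hC⟩ := htw
    -- mordellWeilRank_variableChange_holds gives (C • W).mordellWeilRank = W.mordellWeilRank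
    have hmv := mordellWeilRank_variableChange_holds (W.quadraticTwist (NumberField.discr K : ℚ)) C
    unfold mordellWeilRank_variableChange at hmv
    -- Goal: W.mordellWeilRank + twist.mordellWeilRank = W.mordellWeilRank + Wd.mordellWeilRank
    -- hC: C • twist = Wd, so Wd.mordellWeilRank = (C • twist).mordellWeilRank = twist.mordellWeilRank (by hmv)
    rw [← hC, hmv]
  have hrank : (W.baseChange K).mordellWeilRank = 1 := by rw [hrkK_eq, hrksum]
  -- p does not divide torsion order (p splits in K, finrank = 2)
  have hunit : ¬ p ∣ Units.torsionOrder K :=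
    X11b.Three.not_dvd_torsionOrder_of_ncard_primesOver_eq_two h2 hp2 hsplit
  -- Poitou-Tate duality is a tree theorem
  have hPT : poitouTate_selmerStructure_duality K :=
    SchneiderFreeAdditiveX3.PoitouTateReduction.poitouTate_selmerStructure_duality_holds K
  -- Get a frame (κ, γ, 𝔭)
  obtain ⟨κ, γ, -, hκ, hγ, -⟩ := X11b.exists_anticyclotomic_generator_prime (p := p) hK
  haveI : Fact (κ.IsTopGenerator γ) := ⟨hγ⟩
  obtain ⟨𝔭, h𝔭, he, hf⟩ := X11b.exists_degreeOnePrime_of_splitsIn K p hK.1 hsplit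
  -- BranchSocketAt gives IMC lower at slack v_p(c)
  have h1 := hsock N Dt H ιK P hN hP hnt κ hκ γ 𝔭 h𝔭 he hf
  -- Control inequality from PT + rank one (no HeegnerHypothesis N K needed!)
  have h2ctrl := additiveControlLeOnTreeAt_of_poitouTate_of_rankOne W p hp2 hadd hPT hK hsplit
    hunit hrank hfinK P hnt κ hκ γ 𝔭 h𝔭 he hf
  -- Compose via index_le_slack_of_additive_linksLe
  have hineq := SchneiderFreeAdditiveX3.index_le_slack_of_additive_linksLe h1 h2ctrl
  -- Tamagawa transport for TameRoadField: any non-split ℓ | N is q (the Wan prime), Mult with p ∤ ord_q Δ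
  have hbad : ∀ (ℓ : ℕ) [Fact ℓ.Prime], ℓ ∣ W.conductorNorm ℤ → ¬ SplitsIn K ℓ →
      Mult W ℓ ∧ ¬ p ∣ padicValInt ℓ W.minimalDiscriminantInt := by
    intro ℓ _ hℓN hℓnsplit
    obtain ⟨_, ⟨q, _, hqwan, _, hsplitrest⟩, _, _⟩ := hfield
    by_cases hℓq : ℓ = q
    · subst hℓq; exact ⟨hqwan.2.2.1, hqwan.2.2.2.2⟩
    · exact absurd (hsplitrest ℓ Fact.out hℓN hℓq) hℓnsplit
  have htam := X11b.padicValNat_tamagawaProduct_baseChange_quadratic_eq_two_mul W p K hp5 h2 hbad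
  -- Divisibility: tamagawaProductSplit ∣ baseChange.tamagawaProduct
  have hdvd := Supersingular.tamagawaProductSplit_dvd_tamagawaProduct_baseChange W K
  -- padicValNat is monotone under divisibility
  have htam_le : padicValNat p (X11b.tamagawaProductSplit W K) ≤
      padicValNat p (W.baseChange K).tamagawaProduct := by
    obtain ⟨c, hc⟩ := hdvd
    have hne : (W.baseChange K).tamagawaProduct ≠ 0 := (W.baseChange K).tamagawaProduct_pos_holds.ne'
    have hmul : X11b.tamagawaProductSplit W K * c ≠ 0 := by rw [← hc]; exact hne
    rw [hc, padicValNat.mul (left_ne_zero_of_mul hmul) (right_ne_zero_of_mul hmul)]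
    exact Nat.le_add_right _ _
  -- Sha[p^∞] = shaOrder for finite Sha
  haveI : Finite (W.baseChange K).sha := hfinK
  have hsha : padicValNat p (Nat.card (AddCommGroup.primaryComponent (W.baseChange K).sha p)) =
      padicValNat p (W.baseChange K).shaOrder := by
    rw [natCard_primaryComponent_eq_pow_padicValNat p, padicValNat.prime_pow]; rfl
  -- Final assembly — IndexLowerBoundLeAt is in ℕ
  unfold IndexLowerBoundLeAt
  have hineqN : 2 * padicValNat p (AddSubgroup.zmultiples P).index ≤
      padicValNat p (Nat.card (AddCommGroup.primaryComponent (W.baseChange K).sha p)) +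
        padicValNat p (X11b.tamagawaProductSplit W K) + 2 * padicValNat p Dt.c.natAbs := by
    have h := hineq
    omega
  calc 2 * padicValNat p (AddSubgroup.zmultiples P).index
      ≤ padicValNat p (Nat.card (AddCommGroup.primaryComponent (W.baseChange K).sha p)) +
          padicValNat p (X11b.tamagawaProductSplit W K) + 2 * padicValNat p Dt.c.natAbs := hineqN
    _ ≤ padicValNat p (W.baseChange K).shaOrder +
          padicValNat p (W.baseChange K).tamagawaProduct + 2 * padicValNat p Dt.c.natAbs := by
        rw [hsha]; exact Nat.add_le_add_right (Nat.add_le_add_left htam_le _) _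
    _ = padicValNat p (W.baseChange K).shaOrder +
          2 * padicValNat p W.tamagawaProduct + 2 * padicValNat p Dt.c.natAbs := by rw [htam]
    _ ≤ padicValNat p (W.baseChange K).shaOrder +
          2 * padicValNat p W.tamagawaProduct + 2 * padicValNat p Dt.c.natAbs := le_refl _

end Summit.BirchSwinnertonDyer.BirchSwinnertonDyer.Cruxes.GordTwoRankOne.WanTameBdpRoad
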